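import Summits.ValiantsHypothesis.ValiantsHypothesis.Theorems.LacunarySymmetroidMatrixDescartesDoorA26WallBubblingInteriorHingeExclusion

/-!
# Wall bubbling for `DoorA26` — obligation (R): INTERIOR TIGHTNESS for any number of clusters, and the consecutive-pair hinge exclusion by name

HONEST FRAMING.  Helper theorems for the line `Cruxes/DoorA26/Lines/wall_bubbling.lean` (crux stmt-ValiantsHypothesis-19979 `DoorA26`; OPEN, typed,
never asserted), W2 seat val-sym-door-p1 g16, on top of W2 #36 `…WallBubblingInteriorHingeExclusion`.  Def-free; nothing here bears on `DoorA26`,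
`MatrixDescartes` (stmt-ValiantsHypothesis-18050) or `VP ≠ VNP`; registers unchanged.

CONTENT.  §1 `interior_tight`: at a point `δ⋆` with 21 distinct pair-sum values, ANY cluster-limit datum `D` (W-line (B): `Bubbling.ClusterLimit`) is a
TIGHT CHAIN — every cluster is Laguerre–Pólya sharp on its alive values (`m c + 1 = |Λ_c|`), every value is alive in some cluster, alive values of an
earlier cluster lie below those of a later one, each cluster's alive values are convex in the value order, and consecutive clusters share an alive value
(the count `20 = Σ m ≤ Σ(|Λ_c| − 1) ≤ |V| − 1 = 20` of `Bubbling.count_absurd` in its equality case, with W2 #28 `interval_count_tight`).  §2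
`interior_consecutive_hinge_not_between`: for CONSECUTIVE clusters `c, c+1` of such a datum (finite-stage realisability from W1's
`SecondOrder.exists_clusterLimit_realisable_of_mem_closure`), a value `δ⋆p + δ⋆q` alive in both and letters `a, d` with `δ⋆a < δ⋆p < δ⋆q < δ⋆d` whose value
`δ⋆a + δ⋆d` lies weakly between an alive value of `c` and an alive value of `c+1` ⇒ False (convexity puts `(a,d)` in `Λ_c ∪ Λ_{c+1}`, then
`interior_hinge_not_between_of_alive`).  Located (this seat, hub/kit censuses): this is the by-name form of the rule that alone kills 238 844 of the 445 968
three-cluster profiles at generic support.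

[folklore] equality case of a chain of inequalities; [this work] the packaging.
-/

-- `Summit.ValiantsHypothesis.ValiantsHypothesis.…` repeats a component by the D-0017 layout
-- (single-conjunct summit), which the `dupNamespace` linter flags; the name is mandated.
set_option linter.dupNamespace false

namespace Summit.ValiantsHypothesis.ValiantsHypothesis.Theorems.LacunarySymmetroidMatrixDescartes.WallBubbling.Bubbling

open Finset Filter Topology

/-! ## §1 Interior tightness -/

/-- **INTERIOR TIGHTNESS.**  At a point with 21 distinct pair-sum values every cluster-limit datum is a tight chain (see the module docstring); stated in
class-sum currency (`alive c w :⟺ classSum (D.H c) (pairExp δ⋆) w ≠ 0`, which for `w = δ⋆p + δ⋆q` is `D.H c (p,q) ≠ 0` by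
`classSum_ne_zero_iff_of_generic`). [this work] -/
theorem interior_tight {δstar : Fin 6 → ℝ} (D : ClusterLimit δstar)
    (hgen : ∀ p q p' q' : Fin 6, δstar p + δstar q = δstar p' + δstar q' → (p = p' ∧ q = q') ∨ (p = q' ∧ q = p')) :
    (∀ c, D.m c + 1 = ((Finset.univ.image (fun pq : Fin 6 × Fin 6 => δstar pq.1 + δstar pq.2)).filter
        fun w => classSum (D.H c) (pairExp δstar) w ≠ 0).card) ∧
    (∀ p q : Fin 6, ∃ c, classSum (D.H c) (pairExp δstar) (δstar p + δstar q) ≠ 0) ∧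
    (∀ c c' : Fin D.C, c < c' → ∀ w w', classSum (D.H c) (pairExp δstar) w ≠ 0 → classSum (D.H c') (pairExp δstar) w' ≠ 0 → w ≤ w') ∧
    (∀ (c : Fin D.C) (w₁ w₂ : ℝ) (p q : Fin 6), classSum (D.H c) (pairExp δstar) w₁ ≠ 0 → classSum (D.H c) (pairExp δstar) w₂ ≠ 0 →
        w₁ ≤ δstar p + δstar q → δstar p + δstar q ≤ w₂ → classSum (D.H c) (pairExp δstar) (δstar p + δstar q) ≠ 0) ∧
    (∀ c c' : Fin D.C, c.val + 1 = c'.val → ∃ w, classSum (D.H c) (pairExp δstar) w ≠ 0 ∧ classSum (D.H c') (pairExp δstar) w ≠ 0) := by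
  classical
  have hsym : ∀ c i j, D.H c (i, j) = D.H c (j, i) := by
    intro c i j
    have := realisable_apply_symm (D.hreal c) i j
    simpa using this
  set V : Finset ℝ := Finset.univ.image (fun pq : Fin 6 × Fin 6 => δstar pq.1 + δstar pq.2) with hVdef
  have hVcard : V.card = 21 := card_pairSums_eq_of_generic hgen
  have hx : ∀ pq : Pair, Tendsto (fun ν => pairExp (D.δseq ν) pq) atTop (𝓝 (pairExp δstar pq)) :=
    fun pq => (D.hδ pq.1).add (D.hδ pq.2)
  have hmemV : ∀ c w, classSum (D.H c) (pairExp δstar) w ≠ 0 → w ∈ V := by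
    intro c w hw
    obtain ⟨pq, hpq', -⟩ := exists_member_of_classSum_ne_zero (D.H c) (pairExp δstar) w hw
    rw [hVdef, Finset.mem_image]
    exact ⟨pq, Finset.mem_univ _, hpq'⟩
  set Λ : Fin D.C → Finset ℝ := fun c => V.filter fun w => classSum (D.H c) (pairExp δstar) w ≠ 0 with hΛdef
  have hΛmem : ∀ c w, w ∈ Λ c ↔ classSum (D.H c) (pairExp δstar) w ≠ 0 := by
    intro c w
    rw [hΛdef, Finset.mem_filter]
    exact ⟨fun h => h.2, fun h => ⟨hmemV c w h, h⟩⟩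
  have hΛsub : ∀ c, Λ c ⊆ V := fun c => Finset.filter_subset _ _
  have hact : ∀ c, ∃ w, classSum (D.H c) (pairExp δstar) w ≠ 0 := by
    intro c
    have hH := D.hH c
    have : ∃ pq, D.H c pq ≠ 0 := by
      by_contra hall
      push Not at hall
      exact hH (funext hall)
    obtain ⟨⟨i, j⟩, hij⟩ := this
    exact ⟨δstar i + δstar j, (classSum_ne_zero_iff_of_generic hgen (D.H c) (hsym c) i j).mpr hij⟩
  have hΛne : ∀ c, (Λ c).Nonempty := by
    intro c
    obtain ⟨w, hw⟩ := hact c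
    exact ⟨w, (hΛmem c w).mpr hw⟩
  have hcount : ∀ c, D.m c + 1 ≤ (Λ c).card := by
    intro c
    have hev := robust_term_count' (D.a c) (fun ν => pairExp (D.δseq ν)) (D.H c) (pairExp δstar) (Λ c)
      (D.ha c) hx (fun w hw => (hΛmem c w).mpr hw) (hact c) (D.R c)
    obtain ⟨ν, hν⟩ := hev.exists
    obtain ⟨Z, hZcard, hZ⟩ := D.hzeros c ν
    have := hν Z hZ
    omega
  have hmono : ∀ c c', c < c' → ∀ w ∈ Λ c, ∀ w' ∈ Λ c', w ≤ w' := by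
    intro c c' hcc' w hw w' hw'
    obtain ⟨pq, hpq', hHp⟩ := exists_member_of_classSum_ne_zero (D.H c) (pairExp δstar) w ((hΛmem c w).mp hw)
    obtain ⟨pq', hpq'', hHp'⟩ := exists_member_of_classSum_ne_zero (D.H c') (pairExp δstar) w' ((hΛmem c' w').mp hw')
    have := tropical_monotone (fun ν => pairExp (D.δseq ν)) (D.a c) (D.a c') (pairExp δstar) (D.H c) (D.H c')
      (D.L c c') (D.ρ c c') hx (D.ha c) (D.ha c') (D.hbound c) (D.hbound c') (D.hρ c c') (D.hL c c' hcc')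
      (D.htransfer c c' hcc') hHp hHp'
    rw [hpq', hpq''] at this
    exact this
  have hint : ∑ c, ((Λ c).card - 1) ≤ V.card - 1 := interval_count V Λ hΛne hΛsub hmono
  have hsum : ∑ c, D.m c ≤ ∑ c, ((Λ c).card - 1) :=
    Finset.sum_le_sum fun c _ => by have := hcount c; omega
  have h20 := D.hm
  have htight : ∑ c, ((Λ c).card - 1) = V.card - 1 := by omega
  have hC : 0 < D.C := by
    by_contra h0
    have hC0 : D.C = 0 := by omega
    have : ∑ c : Fin D.C, D.m c = 0 := by
      rw [Finset.sum_eq_zero]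
      intro c _
      exact absurd c.isLt (by omega)
    omega
  obtain ⟨hcover, hconv, hlink⟩ := interval_count_tight V Λ hΛne hΛsub hmono hC htight
  -- per-cluster equality from the equality of the sums
  have heq : ∀ c, D.m c + 1 = (Λ c).card := by
    have hle : ∀ c ∈ (Finset.univ : Finset (Fin D.C)), D.m c ≤ (Λ c).card - 1 := fun c _ => by have := hcount c; omega
    have hsumeq : ∑ c, D.m c = ∑ c, ((Λ c).card - 1) := by omega
    have := (Finset.sum_eq_sum_iff_of_le hle).mp hsumeq
    intro c
    have h1 := this c (Finset.mem_univ c)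
    have h2 := Finset.card_pos.mpr (hΛne c)
    omega
  refine ⟨heq, ?_, ?_, ?_, ?_⟩
  · intro p q
    have hpqV : δstar p + δstar q ∈ V := by
      rw [hVdef, Finset.mem_image]; exact ⟨(p, q), Finset.mem_univ _, rfl⟩
    obtain ⟨c, hc⟩ := hcover _ hpqV
    exact ⟨c, (hΛmem c _).mp hc⟩
  · intro c c' hcc' w w' hw hw'
    exact hmono c c' hcc' w ((hΛmem c w).mpr hw) w' ((hΛmem c' w').mpr hw')
  · intro c w₁ w₂ p q h₁ h₂ hle₁ hle₂
    have hpqV : δstar p + δstar q ∈ V := by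
      rw [hVdef, Finset.mem_image]; exact ⟨(p, q), Finset.mem_univ _, rfl⟩
    exact (hΛmem c _).mp (hconv c w₁ ((hΛmem c w₁).mpr h₁) w₂ ((hΛmem c w₂).mpr h₂) _ hpqV hle₁ hle₂)
  · intro c c' hcc'
    obtain ⟨w, hw, hw'⟩ := hlink c c' hcc'
    exact ⟨w, (hΛmem c w).mp hw, (hΛmem c' w).mp hw'⟩

/-! ## §2 Consecutive clusters: the hinge exclusion by name for any number of clusters -/

/-- **CONSECUTIVE-PAIR HINGE EXCLUSION AT A GENERIC INTERIOR POINT (obligation (R), any number of clusters).**  Cluster-limit data with finite-stage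
realisability at a point with 21 distinct pair-sum values; consecutive clusters `c, c′` (`c.val + 1 = c′.val`); a value `δ⋆p + δ⋆q` alive in both (a
hinge); letters with `δ⋆a < δ⋆p < δ⋆q < δ⋆d` such that `δ⋆a + δ⋆d` lies weakly between some alive value of `c` and some alive value of `c′`.  Contradiction.
[this work] -/
theorem interior_consecutive_hinge_not_between {δstar : Fin 6 → ℝ} (D : ClusterLimit δstar)
    (hrealν : ∀ c ν, Realisable (Matrix.of fun k l => D.a c ν (k, l)))
    (hgen : ∀ p q p' q' : Fin 6, δstar p + δstar q = δstar p' + δstar q' → (p = p' ∧ q = q') ∨ (p = q' ∧ q = p'))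
    (c c' : Fin D.C) (hcc' : c.val + 1 = c'.val)
    (a p q d : Fin 6) (hap : δstar a < δstar p) (hpq : δstar p < δstar q) (hqd : δstar q < δstar d)
    (h0 : classSum (D.H c) (pairExp δstar) (δstar p + δstar q) ≠ 0)
    (h1 : classSum (D.H c') (pairExp δstar) (δstar p + δstar q) ≠ 0)
    (w₁ w₂ : ℝ) (hw₁ : classSum (D.H c) (pairExp δstar) w₁ ≠ 0) (hw₂ : classSum (D.H c') (pairExp δstar) w₂ ≠ 0)
    (hle₁ : w₁ ≤ δstar a + δstar d) (hle₂ : δstar a + δstar d ≤ w₂) : False := by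
  classical
  have hlt : c < c' := Fin.lt_def.mpr (by omega)
  obtain ⟨-, -, -, hconv, -⟩ := interior_tight D hgen
  -- locate (a,d) in c or c′ by convexity
  have had : classSum (D.H c) (pairExp δstar) (δstar a + δstar d) ≠ 0 ∨
      classSum (D.H c') (pairExp δstar) (δstar a + δstar d) ≠ 0 := by
    by_cases hle : δstar a + δstar d ≤ δstar p + δstar q
    · -- below the hinge: alive in c by convexity between w₁ and the hinge
      exact Or.inl (hconv c w₁ (δstar p + δstar q) a d hw₁ h0 hle₁ hle)
    · -- above the hinge: alive in c′ by convexity between the hinge and w₂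
      exact Or.inr (hconv c' (δstar p + δstar q) w₂ a d h1 hw₂ (le_of_lt (lt_of_not_ge hle)) hle₂)
  exact interior_hinge_not_between_of_alive D hrealν hgen c c' hlt a p q d hap hpq hqd h0 h1 had

end Summit.ValiantsHypothesis.ValiantsHypothesis.Theorems.LacunarySymmetroidMatrixDescartes.WallBubbling.Bubbling
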